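import Summits.BirchSwinnertonDyer.BirchSwinnertonDyer.Theorems.SignedLowerHalvesSmallImageLowerHalfBothSignsRttCharRoadE1LocalCores
import HarnessLib

/-!
# Route `SignedLowerHalves`, crux L `SmallImageLowerHalfBothSigns` (stmt-BirchSwinnertonDyer-23599), line `rtt_w3` v11 — brick D3-W AT `p` FOR THE
# CORESTRICTION, BRIDGE to the `k`-side class as it comes out of the base change (memo `Lines/rtt_w3-MEMO-D3c-w3g17.md` §7–§8):
# the `k`-side class lives on `↥(H ⊓ U)` (`H = Γ_{k_n}`, `U = galRange K`; cell bsd-potss's `BaseChange.subgroupH1Iso`, p765761's `hψ`), the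
# transfer `corCocycle`/`corH1` wants it on the subgroup `N = U.subgroupOf H` of `↥H`. This file moves classes along ANY continuous isomorphism
# `e : ↥N ≃ₜ* ↥(H ⊓ U)` over `Γ_k` (one exists: `exists_continuousMulEquiv_subgroupOf_inf`) and restates ★★ of `…E1LocalCores` with the Kummer
# witness hypothesis in p765761's OUTPUT FORM.

Width seat `bsd-line-slh-p3-w3` g17 under LEAD `cruxlead-stmt-BirchSwinnertonDyer-23599` (cell `bsd-ssimc`; `--supports stmt-BirchSwinnertonDyer-23599 --as helper`).
THEOREMS ONLY (no definition, no named fact, no instance, no `sorry`). BSD / crux L / INJ are NOT proved here.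

* `exists_continuousMulEquiv_subgroupOf_inf` — `∃ e : ↥(U.subgroupOf H) ≃ₜ* ↥(H ⊓ U)` over `Γ_k` (`((e n : H ⊓ U) : Γ_k) = n`).
* `smul_eq_smul_of_coe_eq` — such an `e` intertwines the two actions on `E[p^∞]` (the hypothesis of `resHomOfEquivariant e id`).
* `pointsMapOfEmb_pullback_apply_of_kummer` — if `ξ₀ ∈ Z¹(↥(H ⊓ U), E[p^∞])` has local crossed homomorphism `τ ↦ τQ − Q` on
  `Λ' = localSubgroupOfEmb (H ⊓ U) ι` (p765761's form), so does its pullback `e^*ξ₀ ∈ Z¹(N, E[p^∞])` in the form ★ of `…E1LocalCores` consumes.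
* `nsmul_pullback_apply_eq_zero` — `p^a` kills the values of `e^*ξ₀` when it kills those of `ξ₀`.
* ★★★ `corH1_resH1Hom_mem_localKummerOverOfEmb_signed` — at the layers: for `ξ₀ ∈ Z¹(↥(κ.layerSubgroup n ⊓ galRange K), E[p^∞])` killed by `p^a`
  with local crossed homomorphism the Kummer cocycle of `transportPoints Q_K`, `p^{k'}Q_K ∈ E^ε(K_n·E')`, and `c ∈ Λ_n` restricting outside
  `galRange K`: `corH1 (resH1Hom e id [ξ₀]) ∈ localKummerOverOfEmb W p (κ.layerSubgroup n) ι (E^ε(k_n·E))`.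

References: [SerreGaloisCohomology1997] I §2.4, II §1.1; [NeukirchSchmidtWingberg2008] I §5; [Kobayashi2003] Def. 1.1.
-/

set_option autoImplicit false
set_option linter.dupNamespace false -- D-0017: single-problem summit, the namespace repeats the problem name by design
noncomputable section

open scoped Classical

universe u

namespace Summit.BirchSwinnertonDyer.BirchSwinnertonDyer.Theorems.SmallImageCharSignedSelmer

open Literature.NumberTheory.EllipticCurves Literature.NumberTheory.GaloisRepresentations Field
  Summit.BirchSwinnertonDyer.Rank1Residual.Additive.LocalTransport

/-! ## §1 Moving cocycles between `↥(U.subgroupOf H)` and `↥(H ⊓ U)` -/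

section Bridge

variable {k : Type u} [Field k] (W : WeierstrassCurve k) (p : ℕ) (H U : Subgroup (absoluteGaloisGroup k))
  {E : Type u} [Field E] [Algebra k E] (ι : AlgebraicClosure k →ₐ[k] AlgebraicClosure E)

/-- **`↥(U.subgroupOf H) ≃ₜ* ↥(H ⊓ U)` over `Γ_k`** (both are `{g ∈ H | g ∈ U}` with the subspace topology). [folklore] -/
theorem exists_continuousMulEquiv_subgroupOf_inf :
    ∃ e : (U.subgroupOf H) ≃ₜ* (H ⊓ U : Subgroup (absoluteGaloisGroup k)),
      ∀ n : U.subgroupOf H, ((e n : (H ⊓ U : Subgroup (absoluteGaloisGroup k))) : absoluteGaloisGroup k) = ((n : H) : absoluteGaloisGroup k) :=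
  ⟨{ toFun := fun n ↦ ⟨((n : H) : absoluteGaloisGroup k), Subgroup.mem_inf.2 ⟨(n : H).2, Subgroup.mem_subgroupOf.1 n.2⟩⟩
     invFun := fun x ↦ ⟨⟨(x : absoluteGaloisGroup k), (Subgroup.mem_inf.1 x.2).1⟩, Subgroup.mem_subgroupOf.2 (Subgroup.mem_inf.1 x.2).2⟩
     left_inv := fun _ ↦ rfl
     right_inv := fun _ ↦ rfl
     map_mul' := fun _ _ ↦ rfl
     continuous_toFun := (continuous_subtype_val.comp continuous_subtype_val).subtype_mk _
     continuous_invFun := (continuous_subtype_val.subtype_mk _).subtype_mk _ }, fun _ ↦ rfl⟩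

/-- An `e : ↥(U.subgroupOf H) →ₜ* ↥(H ⊓ U)` over `Γ_k` intertwines the two (restricted `Γ_k`-) actions on `E[p^∞]`: the hypothesis of
`resHomOfEquivariant e id`. [folklore] -/
theorem smul_eq_smul_of_coe_eq (e : (U.subgroupOf H) →ₜ* (H ⊓ U : Subgroup (absoluteGaloisGroup k)))
    (he : ∀ n : U.subgroupOf H, ((e n : (H ⊓ U : Subgroup (absoluteGaloisGroup k))) : absoluteGaloisGroup k) = ((n : H) : absoluteGaloisGroup k))
    (x : U.subgroupOf H) (m : W.geomPrimaryTorsion p) :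
    (AddMonoidHom.id (W.geomPrimaryTorsion p)) (e x • m) = x • (AddMonoidHom.id (W.geomPrimaryTorsion p)) m := by
  simp only [AddMonoidHom.id_apply, Subgroup.smul_def, he]

/-- **Pullback keeps the Kummer witness.** If on `Λ' = localSubgroupOfEmb (H ⊓ U) ι` the local crossed homomorphism of
`ξ₀ ∈ Z¹(↥(H ⊓ U), E[p^∞])` is `τ ↦ τQ − Q` (the output form of `pointsMapOfEmb_eq_smul_transportPoints_sub`, p765761), then the pullback
`e^*ξ₀ ∈ Z¹(↥(U.subgroupOf H), E[p^∞])` has the same local crossed homomorphism, in the input form of `pointsMapOfEmb_corCocycle_apply`.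
[cite: SerreGaloisCohomology1997, I §2.4] -/
theorem pointsMapOfEmb_pullback_apply_of_kummer (e : (U.subgroupOf H) →ₜ* (H ⊓ U : Subgroup (absoluteGaloisGroup k)))
    (he : ∀ n : U.subgroupOf H, ((e n : (H ⊓ U : Subgroup (absoluteGaloisGroup k))) : absoluteGaloisGroup k) = ((n : H) : absoluteGaloisGroup k))
    (ξ₀ : contOneCocycles (discreteTopRep (H ⊓ U : Subgroup (absoluteGaloisGroup k)) (W.geomPrimaryTorsion p))) (Q : localPoints W E)
    (hξ₀ : ∀ τ : localSubgroupOfEmb (H ⊓ U) ι,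
      pointsMapOfEmb W ι ((ξ₀.1 (resGalSubgroupOfEmb (H ⊓ U) ι τ) : W.geomPrimaryTorsion p) : W.geomPoints) =
        (τ : absoluteGaloisGroup E) • Q - Q)
    (τ : absoluteGaloisGroup E) (hτ : τ ∈ localSubgroupOfEmb (H ⊓ U) ι) :
    pointsMapOfEmb W ι (((contOneCocycles.pullback e
        (resHomOfEquivariant e (AddMonoidHom.id (W.geomPrimaryTorsion p)) (smul_eq_smul_of_coe_eq W p H U e he)) ξ₀).1
        ⟨resGalSubgroupOfEmb H ι ⟨τ, localSubgroupOfEmb_inf_le H U ι hτ⟩, resGalSubgroupOfEmb_mem_subgroupOf H U ι hτ⟩ :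
          W.geomPrimaryTorsion p) : W.geomPoints) = τ • Q - Q := by
  have hn : e ⟨resGalSubgroupOfEmb H ι ⟨τ, localSubgroupOfEmb_inf_le H U ι hτ⟩, resGalSubgroupOfEmb_mem_subgroupOf H U ι hτ⟩ =
      resGalSubgroupOfEmb (H ⊓ U) ι ⟨τ, hτ⟩ := by
    apply Subtype.ext
    rw [he, resGalSubgroupOfEmb_apply_coe, resGalSubgroupOfEmb_apply_coe]
  rw [contOneCocycles.pullback_apply, hn]
  exact hξ₀ ⟨τ, hτ⟩

/-- `m` kills the values of `e^*ξ₀` when it kills those of `ξ₀`. [folklore] -/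
theorem nsmul_pullback_apply_eq_zero (e : (U.subgroupOf H) →ₜ* (H ⊓ U : Subgroup (absoluteGaloisGroup k)))
    (he : ∀ n : U.subgroupOf H, ((e n : (H ⊓ U : Subgroup (absoluteGaloisGroup k))) : absoluteGaloisGroup k) = ((n : H) : absoluteGaloisGroup k))
    (ξ₀ : contOneCocycles (discreteTopRep (H ⊓ U : Subgroup (absoluteGaloisGroup k)) (W.geomPrimaryTorsion p))) {m : ℕ}
    (hm : ∀ x, m • ξ₀.1 x = 0) (n : U.subgroupOf H) :
    m • (contOneCocycles.pullback e
      (resHomOfEquivariant e (AddMonoidHom.id (W.geomPrimaryTorsion p)) (smul_eq_smul_of_coe_eq W p H U e he)) ξ₀).1 n = 0 := by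
  rw [contOneCocycles.pullback_apply]
  exact hm (e n)

/-- `resH1Hom e id [ξ₀] = [e^*ξ₀]` (the tree's `map_oneCocycleClass`). [cite: SerreGaloisCohomology1997, I §2.4] -/
theorem resH1Hom_oneCocycleClass_eq_pullback (e : (U.subgroupOf H) →ₜ* (H ⊓ U : Subgroup (absoluteGaloisGroup k)))
    (he : ∀ n : U.subgroupOf H, ((e n : (H ⊓ U : Subgroup (absoluteGaloisGroup k))) : absoluteGaloisGroup k) = ((n : H) : absoluteGaloisGroup k))
    (ξ₀ : contOneCocycles (discreteTopRep (H ⊓ U : Subgroup (absoluteGaloisGroup k)) (W.geomPrimaryTorsion p))) :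
    resH1Hom e (AddMonoidHom.id (W.geomPrimaryTorsion p)) (smul_eq_smul_of_coe_eq W p H U e he)
        (oneCocycleClass (discreteTopRep (H ⊓ U : Subgroup (absoluteGaloisGroup k)) (W.geomPrimaryTorsion p)) ξ₀) =
      oneCocycleClass (discreteTopRep (U.subgroupOf H) (W.geomPrimaryTorsion p)) (contOneCocycles.pullback e
        (resHomOfEquivariant e (AddMonoidHom.id (W.geomPrimaryTorsion p)) (smul_eq_smul_of_coe_eq W p H U e he)) ξ₀) :=
  map_oneCocycleClass (X := discreteTopRep (H ⊓ U : Subgroup (absoluteGaloisGroup k)) (W.geomPrimaryTorsion p))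
    (Y := discreteTopRep (U.subgroupOf H) (W.geomPrimaryTorsion p)) e
    (resHomOfEquivariant e (AddMonoidHom.id _) (smul_eq_smul_of_coe_eq W p H U e he)) ξ₀

end Bridge

/-! ## §2 At the layers: the corestriction of the base-changed class satisfies the signed Kummer condition -/

section Layers

variable {k : Type u} [Field k] [NumberField k] {p : ℕ} [hp : Fact p.Prime] (hp2 : p ≠ 2) (κ : ZpExtension k p)
  (K : Type u) [Field K] [NumberField K] [Algebra k K] (hK2 : Module.finrank k K = 2)
  {E : Type u} [Field E] [Algebra k E] {E' : Type u} [Field E'] [Algebra K E'] [Algebra E E'] [Algebra k E'] [IsScalarTower k K E']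
  (ι : AlgebraicClosure k →ₐ[k] AlgebraicClosure E) (ι₂ : AlgebraicClosure E ≃+* AlgebraicClosure E')
  (ι' : AlgebraicClosure K →ₐ[K] AlgebraicClosure E')
  (hcompat : ∀ z : AlgebraicClosure k, ι' (closureEmb (K := k) K z) = ι₂ (ι z))
  (hι₂ : ∀ a : E, ι₂ (algebraMap E (AlgebraicClosure E) a) = algebraMap E' (AlgebraicClosure E') (algebraMap E E' a))
  (hfixU : ∀ h : absoluteGaloisGroup E, resGalOfEmb ι h ∈ galRange (K := k) K → ∀ y : E',
    (show AlgebraicClosure E ≃ₐ[E] AlgebraicClosure E from h) (ι₂.symm (algebraMap E' (AlgebraicClosure E') y)) =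
      ι₂.symm (algebraMap E' (AlgebraicClosure E') y))
  (hU : (galRange (K := k) K).index = 2) (W : WeierstrassCurve k) (ε : ℤˣ) (n : ℕ)
  [((galRange (K := k) K).subgroupOf (κ.layerSubgroup n)).Normal]

include hι₂ hfixU in
/-- ★★★ **D3-W at `p` for `cor` of the base-changed class.** At layer `n` (`H = κ.layerSubgroup n`, `U = galRange K`, `N = U.subgroupOf H`,
`e : ↥N →ₜ* ↥(H ⊓ U)` over `Γ_k`, `c ∈ Λ_n` with `res_ι c ∉ U` the transversal): if `ξ₀ ∈ Z¹(↥(H ⊓ U), E[p^∞])` is killed by `p^a` and its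
local crossed homomorphism on `Λ'_n` is the Kummer cocycle of `Q = transportPoints Q_K` (p765761) with `p^{k'}Q_K ∈ E^ε(K_n·E')`, then
`corH1 (resH1Hom e id [ξ₀]) ∈ localKummerOverOfEmb W p Γ_{k_n} ι (E^ε(k_n·E))`. (§1 + `corH1_mem_localKummerOverOfEmb_signed` of `…E1LocalCores`.)
[cite: Kobayashi2003, Def. 1.1] [cite: SerreGaloisCohomology1997, I §2.4] [cite: NeukirchSchmidtWingberg2008, I §5] -/
theorem corH1_resH1Hom_mem_localKummerOverOfEmb_signed
    (e : ((galRange (K := k) K).subgroupOf (κ.layerSubgroup n)) →ₜ* (κ.layerSubgroup n ⊓ galRange (K := k) K : Subgroup (absoluteGaloisGroup k)))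
    (he : ∀ x : (galRange (K := k) K).subgroupOf (κ.layerSubgroup n),
      ((e x : (κ.layerSubgroup n ⊓ galRange (K := k) K : Subgroup (absoluteGaloisGroup k))) : absoluteGaloisGroup k) =
        ((x : κ.layerSubgroup n) : absoluteGaloisGroup k))
    {c : absoluteGaloisGroup E} (hc : c ∈ localSubgroupOfEmb (κ.layerSubgroup n) ι) (hcU : resGalOfEmb ι c ∉ galRange (K := k) K)
    (hN : IsOpen (((galRange (K := k) K).subgroupOf (κ.layerSubgroup n) : Subgroup (κ.layerSubgroup n)) : Set (κ.layerSubgroup n)))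
    (hM : ∀ m : W.geomPrimaryTorsion p, Continuous fun g : κ.layerSubgroup n ↦ g • m)
    (ξ₀ : contOneCocycles (discreteTopRep (κ.layerSubgroup n ⊓ galRange (K := k) K : Subgroup (absoluteGaloisGroup k)) (W.geomPrimaryTorsion p)))
    {a : ℕ} (ha : ∀ x, p ^ a • ξ₀.1 x = 0) (Q_K : localPoints (W.baseChange K) E') (k' : ℕ)
    (hQA : p ^ k' • Q_K ∈ Kobayashi2003.signedLocalPointsOfEmb (κ.restrictOfFinrankEqTwo hp2 K hK2) ι' (W.baseChange K) ε n)
    (hξ₀ : ∀ τ : localSubgroupOfEmb (κ.layerSubgroup n ⊓ galRange (K := k) K) ι,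
      pointsMapOfEmb W ι ((ξ₀.1 (resGalSubgroupOfEmb (κ.layerSubgroup n ⊓ galRange (K := k) K) ι τ) : W.geomPrimaryTorsion p) : W.geomPoints) =
        (τ : absoluteGaloisGroup E) • transportPoints K ι ι₂ ι' hcompat W Q_K - transportPoints K ι ι₂ ι' hcompat W Q_K) :
    corH1 hN hM (xor_mem_subgroupOf_of_index_two (κ.layerSubgroup n) (galRange (K := k) K) ι hU hc hcU)
        (resH1Hom e (AddMonoidHom.id (W.geomPrimaryTorsion p)) (smul_eq_smul_of_coe_eq W p (κ.layerSubgroup n) (galRange (K := k) K) e he)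
          (oneCocycleClass (discreteTopRep (κ.layerSubgroup n ⊓ galRange (K := k) K : Subgroup (absoluteGaloisGroup k)) (W.geomPrimaryTorsion p)) ξ₀)) ∈
      Kobayashi2003.localKummerOverOfEmb W p (κ.layerSubgroup n) ι (Kobayashi2003.signedLocalPointsOfEmb κ ι W ε n) := by
  rw [resH1Hom_oneCocycleClass_eq_pullback W p (κ.layerSubgroup n) (galRange (K := k) K) e he ξ₀]
  exact corH1_mem_localKummerOverOfEmb_signed hp2 κ K hK2 ι ι₂ ι' hcompat hι₂ hfixU hU W ε n hc hcU hN hM _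
    (nsmul_pullback_apply_eq_zero W p (κ.layerSubgroup n) (galRange (K := k) K) e he ξ₀ ha) Q_K k' hQA
    (pointsMapOfEmb_pullback_apply_of_kummer W p (κ.layerSubgroup n) (galRange (K := k) K) ι e he ξ₀ _ hξ₀)

end Layers

end Summit.BirchSwinnertonDyer.BirchSwinnertonDyer.Theorems.SmallImageCharSignedSelmer

end
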